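import Summits.Ventures.CertifiedManyBodySolver.Upper.IntervalReaderH1
import Literature.MathematicalPhysics.QuantumChemistry.SectorWeinsteinEnclosure
import Literature.MathematicalPhysics.QuantumChemistry.TempleThirringBoundsProofs

/-!
# Ventures/CertifiedManyBodySolver — Upper/IntervalReaderMoments.lean: PHASE C of the interval reader BY VALUE
(part 5 of the Theorem-H1′ package; parts 1–4: `IntervalReaderSchur`, `IntervalReaderTransfer`,
`IntervalReaderH1`, `IntervalReaderBridge`)

HONEST FRAMING: first certified bounds; not a superconductivity verdict; every number certified or labelled
float.  This file is about what the reader's PRINTED MOMENT NUMBERS mean; it certifies no number, moves no row,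
and says nothing about the thermodynamic limit or about any order parameter.  An energy window is NEVER an
order-parameter word (LADDER-Hubbard v1.17 WORDING OF RECORD (i)).

Source read against the code: `l3core 0.6.9` (binary of record, SHA256SUMS sha16 `5fda02e5cf27520d`),
`h1sweep.py` class `IntervalMoments` (l.394–424) and `grid_main.py` PHASE C (l.546–562: "Theorem-H1′ `⟨H²⟩` by
source-site stripes ⇒ certified variance upper bound and Weinstein window of the BOX state (box diagnostic, not
a TL bound)").  Parts 1–3 prove that the sweep ENCLOSES the three chain contractions of a witness `ψ`:
`n = ⟨ψ|ψ⟩ ∈ [n_lo, n_hi]` (`0 < n_lo`, asserted by the code), `h = den·⟨ψ|H|ψ⟩ ∈ [h_lo, h_hi]` and — PHASE C —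
`h2 = den²·⟨ψ|H²|ψ⟩ ∈ [h2_lo, h2_hi]` (`den > 0` the common denominator of the couplings).  `IntervalMoments`
then computes, in exact rationals,

* `mu_lo, mu_hi` = min / max of the four corners `h_• / (den · n_•)`            — here `cornerMin`, `cornerMax`;
* `m2_lo, m2_hi` = min / max of the four corners `h2_• / (den² · n_•)`;
* `musq_min = 0 if mu_lo ≤ 0 ≤ mu_hi else min (mu_lo², mu_hi²)`                — here `musqMin`;
* `var_hi = max (0, m2_hi − musq_min)`                                          — here `varHi`;
* `weinstein(bits) = (mu_lo − s, mu_hi + s)` with `s = isqrt_ceil_fraction(var_hi, bits)`, i.e. ANY rational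
  `s ≥ 0` with `var_hi ≤ s²` (the rounding direction is UP; checkable by value);
* `temple_lower(β) = min over μ ∈ {mu_lo, mu_hi} of (β·μ − m2_hi)/(β − μ)`, offered only when `mu_hi < β`
                                                                                — here `templeLower`.

Proved here (0 sorry; the spectral facts are the tree's, REUSED, not restated):

* §E the ARITHMETIC is sound for the true moments: with `μ = ⟨ψ|H|ψ⟩/⟨ψ|ψ⟩` and `m₂ = ⟨ψ|H²|ψ⟩/⟨ψ|ψ⟩`,
  `cornerMin ≤ μ ≤ cornerMax` (two-sided four-corner hull, from part 3's `corner_rule` / `corner_rule_lower`),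
  `musqMin ≤ μ²`, `m₂ − μ² ≤ varHi`, the window lemma `mem_window_of_sq_sub_le`, and `templeLower ≤
  (β μ − m₂)/(β − μ)` (`templeLower_le`: the map `μ ↦ (β μ − m2_hi)/(β − μ)` is monotone on `μ < β`, its sign of
  slope being that of `β² − m2_hi`, so the minimum over `[mu_lo, mu_hi]` sits at an end point — the code's comment
  "monotone in mu for fixed m2; worst m2 = m2_hi").
* §F the PRINTS are sound as OPERATOR statements, for a Hermitian matrix `A`, an `A`-invariant subspace `K`
  (the symmetry sector carrying the witness) and a nonzero `ψ ∈ K`: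
  `weinstein_window_sound` — the printed window `[mu_lo − s, mu_hi + s]` contains an eigenvalue of `A` that has
  an eigenvector IN `K` (tree: Weinstein's enclosure in the variance form,
  `Literature.MathematicalPhysics.QuantumChemistry.exists_eigenOn_sq_sub_rayleigh_le_variance`, Horn–Johnson
  (6.3.17) / Weinstein 1934); `temple_lower_sound` — IF every eigenvalue of `A|_K` other than the least is `≥ β`
  and `mu_hi < β`, then `templeLower β … ≤ minEnergyOn A K` (tree: `templeInequality_holds`, Reed–Simon XIII.5);
  `weinstein_window_sound_sector` — the same window statement in the `(N↑, N↓) = (a, b)` sector of the spinful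
  Fock space for an `H` commuting with `N̂` and `Ŝ_z` (FORMAT-mps1 witnesses are `U(1)²` block-sparse, i.e.
  sector-pure).

What the window IS: an interval containing SOME eigenvalue of the finite BOX operator restricted to the
witness's sector — not the ground energy, not a two-sided bound on it, not a thermodynamic-limit statement.
What `temple_lower` NEEDS: the gap input `β ≤ λ₂(A|_K)`, which NO instrument on the books certifies for the
production boxes; a second Ritz value minus its residual is NOT such an input (tree barrier
`Literature/Barriers/CertifiedQuantumChemistry/ExcitedRitzResidualNotGapCertificate.lean`).  The code offers
`temple_lower(beta)` as a function of a caller-supplied `beta` and prints no Temple number in `grid_main`.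
As in parts 1–4, that the code's integer GEMMs are exact and that E1's automaton MPO equals `H` (so that the
enclosed `h`, `h2` are the moments of THE Hamiltonian) are properties of the bytes, exercised by the lineage's
self-tests, blind planted suites and non-author replays, not formalised here.
-/

noncomputable section

open Matrix
open scoped ComplexOrder

namespace Summit.Ventures.CertifiedManyBodySolver.Upper.IntervalReader

open Literature.MathematicalPhysics.QuantumLattice
open Literature.MathematicalPhysics.QuantumLattice.EigenvalueContinuation
open Literature.MathematicalPhysics.QuantumChemistry

/-! ## §E  The arithmetic of `IntervalMoments` -/

/-- `min` of the four corners `x_• / y_•` of a quotient box — the code's `mu_lo = min(cands)` (with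
`x = h`, `y = den·n`) and `m2_lo` (with `x = h2`, `y = den²·n`). -/
def cornerMin (xlo xhi ylo yhi : ℝ) : ℝ :=
  min (min (xlo / ylo) (xlo / yhi)) (min (xhi / ylo) (xhi / yhi))

/-- `max` of the four corners `x_• / y_•` of a quotient box — the code's `mu_hi = max(cands)` and `m2_hi`. -/
def cornerMax (xlo xhi ylo yhi : ℝ) : ℝ :=
  max (max (xlo / ylo) (xlo / yhi)) (max (xhi / ylo) (xhi / yhi))

/-- **Four-corner hull, lower edge**: for `y ∈ [ylo, yhi]` with `0 < ylo` and `xlo ≤ x`,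
`cornerMin xlo xhi ylo yhi ≤ x / y` (part 3's `corner_rule_lower`; the two `xhi` corners only enlarge the
`min`). -/
theorem cornerMin_le_div {x y xlo xhi ylo yhi : ℝ} (hylo : 0 < ylo) (hy1 : ylo ≤ y) (hy2 : y ≤ yhi)
    (hx1 : xlo ≤ x) : cornerMin xlo xhi ylo yhi ≤ x / y :=
  (min_le_left _ _).trans (corner_rule_lower hylo hy1 hy2 hx1)

/-- **Four-corner hull, upper edge**: for `y ∈ [ylo, yhi]` with `0 < ylo` and `x ≤ xhi`,
`x / y ≤ cornerMax xlo xhi ylo yhi` (part 3's `corner_rule`). -/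
theorem div_le_cornerMax {x y xlo xhi ylo yhi : ℝ} (hylo : 0 < ylo) (hy1 : ylo ≤ y) (hy2 : y ≤ yhi)
    (hx2 : x ≤ xhi) : x / y ≤ cornerMax xlo xhi ylo yhi :=
  (corner_rule hylo hy1 hy2 hx2).trans (le_max_right _ _)

/-- The code's `musq_min`: a lower bound for `μ²` over `μ ∈ [lo, hi]` — `0` if the interval straddles `0`,
else the smaller squared end point. -/
def musqMin (lo hi : ℝ) : ℝ :=
  if lo ≤ 0 ∧ 0 ≤ hi then 0 else min (lo * lo) (hi * hi)

/-- `musq_min` is sound: `musqMin lo hi ≤ μ²` for every `μ ∈ [lo, hi]`. -/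
theorem musqMin_le_mul_self {μ lo hi : ℝ} (h1 : lo ≤ μ) (h2 : μ ≤ hi) : musqMin lo hi ≤ μ * μ := by
  unfold musqMin
  split_ifs with h
  · exact mul_self_nonneg μ
  · rcases not_and_or.mp h with h | h
    · -- `0 < lo ≤ μ`
      exact (min_le_left _ _).trans (mul_self_le_mul_self (le_of_lt (not_le.mp h)) h1)
    · -- `μ ≤ hi < 0`: compare `(-hi)² ≤ (-μ)²`
      have hhi : hi < 0 := not_le.mp h
      have key : (-hi) * (-hi) ≤ (-μ) * (-μ) :=
        mul_self_le_mul_self (neg_nonneg.mpr hhi.le) (neg_le_neg h2)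
      rw [neg_mul_neg, neg_mul_neg] at key
      exact (min_le_right _ _).trans key

/-- The code's `var_hi = max (0, m2_hi − musq_min)`: the certified upper bound on the energy variance of the
witness. -/
def varHi (m2hi lo hi : ℝ) : ℝ :=
  max 0 (m2hi - musqMin lo hi)

/-- `0 ≤ varHi` (so its square root, rounded up, is a real window half-width). -/
theorem varHi_nonneg (m2hi lo hi : ℝ) : 0 ≤ varHi m2hi lo hi :=
  le_max_left _ _

/-- `var_hi` is sound: for `m₂ ≤ m2_hi` and `μ ∈ [lo, hi]`, the variance `m₂ − μ²` is `≤ varHi m2hi lo hi`.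
(The code decouples `m₂` and `μ` — a sound over-estimate.) -/
theorem sub_sq_le_varHi {m2 μ m2hi lo hi : ℝ} (hm2 : m2 ≤ m2hi) (h1 : lo ≤ μ) (h2 : μ ≤ hi) :
    m2 - μ ^ 2 ≤ varHi m2hi lo hi := by
  have hμ := musqMin_le_mul_self h1 h2
  rw [sq]
  exact le_max_of_le_right (by linarith)

/-- **The window arithmetic.**  If some real `e` satisfies `(e − μ)² ≤ m₂ − μ²` (Weinstein's variance enclosure
for the TRUE moments), the true moments satisfy `m₂ ≤ m2_hi`, `μ ∈ [lo, hi]`, and the printed half-width `s`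
satisfies `0 ≤ s`, `var_hi ≤ s²` (the code's `isqrt_ceil_fraction` rounds the square root UP), then
`e ∈ [lo − s, hi + s]` — the code's `weinstein()` pair. -/
theorem mem_window_of_sq_sub_le {e μ m2 m2hi lo hi s : ℝ} (he : (e - μ) ^ 2 ≤ m2 - μ ^ 2) (hm2 : m2 ≤ m2hi)
    (h1 : lo ≤ μ) (h2 : μ ≤ hi) (hs : 0 ≤ s) (hs2 : varHi m2hi lo hi ≤ s ^ 2) :
    lo - s ≤ e ∧ e ≤ hi + s := by
  have hsq : (e - μ) ^ 2 ≤ s ^ 2 := he.trans ((sub_sq_le_varHi hm2 h1 h2).trans hs2)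
  have habs : |e - μ| ≤ s := abs_le_of_sq_le_sq hsq hs
  constructor
  · linarith [(abs_le.mp habs).1]
  · linarith [(abs_le.mp habs).2]

/-- The code's `temple_lower(beta)`: `min` over the two end points `μ ∈ {lo, hi}` of `(β μ − m2_hi)/(β − μ)`. -/
def templeLower (β lo hi m2hi : ℝ) : ℝ :=
  min ((β * lo - m2hi) / (β - lo)) ((β * hi - m2hi) / (β - hi))

/-- `temple_lower` is a sound lower estimate of Temple's expression: for `μ ∈ [lo, hi]`, `hi < β` and
`m₂ ≤ m2_hi`, `templeLower β lo hi m2hi ≤ (β μ − m₂)/(β − μ)`.  Proof = the code's comment: in `m₂` the expression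
decreases (denominator `β − μ > 0`); in `μ`, for fixed `m2_hi`, it is monotone on `(−∞, β)` — increasing if
`m2_hi ≤ β²`, decreasing otherwise — so its minimum over `[lo, hi]` is attained at an end point. -/
theorem templeLower_le {μ m2 β lo hi m2hi : ℝ} (h1 : lo ≤ μ) (h2 : μ ≤ hi) (hβ : hi < β) (hm2 : m2 ≤ m2hi) :
    templeLower β lo hi m2hi ≤ (β * μ - m2) / (β - μ) := by
  have hβμ : 0 < β - μ := by linarith
  have hβlo : 0 < β - lo := by linarith
  have hβhi : 0 < β - hi := by linarith
  have step1 : (β * μ - m2hi) / (β - μ) ≤ (β * μ - m2) / (β - μ) :=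
    div_le_div_of_nonneg_right (by linarith) hβμ.le
  refine le_trans ?_ step1
  unfold templeLower
  rcases le_or_gt m2hi (β * β) with hcase | hcase
  · -- `m2_hi ≤ β²`: increasing in `μ`, the `lo` corner is the smaller one
    refine (min_le_left _ _).trans ?_
    rw [div_le_div_iff₀ hβlo hβμ]
    nlinarith [mul_nonneg (sub_nonneg.mpr hcase) (sub_nonneg.mpr h1)]
  · -- `β² < m2_hi`: decreasing in `μ`, the `hi` corner is the smaller one
    refine (min_le_right _ _).trans ?_
    rw [div_le_div_iff₀ hβhi hβμ]
    nlinarith [mul_nonneg (sub_nonneg.mpr hcase.le) (sub_nonneg.mpr h2)]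

/-! ## §F  The prints as operator statements -/

section Operator

variable {ι : Type*} [Fintype ι]

/-- Quotients are unchanged by the common positive factor the reader carries (`den`, `den²`):
`(c·a)/(c·n) = a/n`. -/
private theorem mul_div_mul_left_pos {c a n : ℝ} (hc : 0 < c) : c * a / (c * n) = a / n :=
  mul_div_mul_left a n hc.ne'

/-- Temple's expression in the two printed shapes: `μ − (m₂ − μ²)/(β − μ) = (β μ − m₂)/(β − μ)` (`β ≠ μ`). -/
private theorem temple_expr_eq {μ m β : ℝ} (h : β - μ ≠ 0) :
    μ - (m - μ ^ 2) / (β - μ) = (β * μ - m) / (β - μ) := by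
  field_simp
  ring

/-- **PHASE C — the Weinstein window is sound.**  `A` Hermitian, `K` an `A`-invariant subspace, `ψ ∈ K`
nonzero (the witness and its symmetry sector).  Reader enclosures BY VALUE: `⟨ψ|ψ⟩ ∈ [nlo, nhi]` with `0 < nlo`,
`den·⟨ψ|A|ψ⟩ ∈ [hlo, hhi]`, `den²·⟨ψ|A²|ψ⟩ ≤ h2hi` (`0 < den`; the lower `h2` edge `h2lo` enters the code's
`m2_hi` only through the `max`, so no hypothesis on it is needed), and a printed half-width `s ≥ 0` with
`var_hi ≤ s²`.  THEN the printed window `[mu_lo − s, mu_hi + s]` contains an eigenvalue `e` of `A` having an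
eigenvector in `K`.  Spectral input: the tree's `exists_eigenOn_sq_sub_rayleigh_le_variance` (Weinstein 1934 /
Horn–Johnson (6.3.17)), not restated.  A BOX DIAGNOSTIC: some eigenvalue of the finite operator — not the least
one, not a thermodynamic-limit number, never an order-parameter statement. -/
theorem weinstein_window_sound {A : Matrix ι ι ℂ} (hA : A.IsHermitian) (K : Submodule ℂ (ι → ℂ))
    (hKA : ∀ v ∈ K, A *ᵥ v ∈ K) {ψ : ι → ℂ} (hψ : ψ ∈ K) (h0 : ψ ≠ 0)
    {den nlo nhi hlo hhi h2lo h2hi s : ℝ} (hden : 0 < den) (hnlo : 0 < nlo)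
    (hn1 : nlo ≤ (star ψ ⬝ᵥ ψ).re) (hn2 : (star ψ ⬝ᵥ ψ).re ≤ nhi)
    (hh1 : hlo ≤ den * (star ψ ⬝ᵥ A *ᵥ ψ).re) (hh2 : den * (star ψ ⬝ᵥ A *ᵥ ψ).re ≤ hhi)
    (hh2hi : den ^ 2 * (star ψ ⬝ᵥ (A * A) *ᵥ ψ).re ≤ h2hi) (hs : 0 ≤ s)
    (hs2 : varHi (cornerMax h2lo h2hi (den ^ 2 * nlo) (den ^ 2 * nhi))
      (cornerMin hlo hhi (den * nlo) (den * nhi)) (cornerMax hlo hhi (den * nlo) (den * nhi)) ≤ s ^ 2) :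
    ∃ e : ℝ, (∃ v ∈ K, v ≠ 0 ∧ A *ᵥ v = (e : ℂ) • v) ∧
      cornerMin hlo hhi (den * nlo) (den * nhi) - s ≤ e ∧
        e ≤ cornerMax hlo hhi (den * nlo) (den * nhi) + s := by
  set n : ℝ := (star ψ ⬝ᵥ ψ).re with hn
  set a : ℝ := (star ψ ⬝ᵥ A *ᵥ ψ).re with ha
  set b : ℝ := (star ψ ⬝ᵥ (A * A) *ᵥ ψ).re with hb
  have hnpos : 0 < n := re_star_dotProduct_self_pos h0
  have hden2 : 0 < den ^ 2 := pow_pos hden 2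
  obtain ⟨e, he, hle⟩ := exists_eigenOn_sq_sub_rayleigh_le_variance hA K hKA hψ h0
  refine ⟨e, he, ?_⟩
  -- the true quotients `μ = a/n`, `m₂ = b/n` in the reader's scaled form
  have hμ : a / n = den * a / (den * n) := (mul_div_mul_left_pos hden).symm
  have hm2 : b / n = den ^ 2 * b / (den ^ 2 * n) := (mul_div_mul_left_pos hden2).symm
  have hy1 : den * nlo ≤ den * n := mul_le_mul_of_nonneg_left hn1 hden.le
  have hy2 : den * n ≤ den * nhi := mul_le_mul_of_nonneg_left hn2 hden.le
  have hy1' : den ^ 2 * nlo ≤ den ^ 2 * n := mul_le_mul_of_nonneg_left hn1 hden2.le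
  have hy2' : den ^ 2 * n ≤ den ^ 2 * nhi := mul_le_mul_of_nonneg_left hn2 hden2.le
  have hμlo : cornerMin hlo hhi (den * nlo) (den * nhi) ≤ a / n := by
    rw [hμ]; exact cornerMin_le_div (mul_pos hden hnlo) hy1 hy2 hh1
  have hμhi : a / n ≤ cornerMax hlo hhi (den * nlo) (den * nhi) := by
    rw [hμ]; exact div_le_cornerMax (mul_pos hden hnlo) hy1 hy2 hh2
  have hm2hi : b / n ≤ cornerMax h2lo h2hi (den ^ 2 * nlo) (den ^ 2 * nhi) := by
    rw [hm2]; exact div_le_cornerMax (mul_pos hden2 hnlo) hy1' hy2' hh2hi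
  exact mem_window_of_sq_sub_le hle hm2hi hμlo hμhi hs hs2

/-- **PHASE C — `temple_lower(β)` is sound GIVEN the gap input.**  Same reader enclosures as
`weinstein_window_sound`; IN ADDITION the Temple hypothesis: every eigenvalue of `A` with an eigenvector in `K`
other than the least one (`minEnergyOn A K`) is `≥ β`, and the code's guard `mu_hi < β`.  THEN
`templeLower β mu_lo mu_hi m2_hi ≤ minEnergyOn A K` — a LOWER bound on the least eigenvalue of `A|_K`.
Spectral input: the tree's `templeInequality_holds` (Temple 1928; Reed–Simon IV Thm XIII.5), applied to the
normalised witness; not restated.  HONEST FRAMING: `β` is an input no instrument on the books certifies for the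
production boxes (barrier `ExcitedRitzResidualNotGapCertificate`: a second Ritz value minus its residual is not
a certified `β`); with a certified `β` this would be a two-sided BOX statement, still not a TL bound. -/
theorem temple_lower_sound {A : Matrix ι ι ℂ} (hA : A.IsHermitian) (K : Submodule ℂ (ι → ℂ))
    (hKA : ∀ v ∈ K, A *ᵥ v ∈ K) {β : ℝ}
    (hgap : ∀ (e : ℝ) (v : ι → ℂ), v ∈ K → v ≠ 0 → A *ᵥ v = (e : ℂ) • v → e ≠ A.minEnergyOn K → β ≤ e)
    {ψ : ι → ℂ} (hψ : ψ ∈ K) (h0 : ψ ≠ 0)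
    {den nlo nhi hlo hhi h2lo h2hi : ℝ} (hden : 0 < den) (hnlo : 0 < nlo)
    (hn1 : nlo ≤ (star ψ ⬝ᵥ ψ).re) (hn2 : (star ψ ⬝ᵥ ψ).re ≤ nhi)
    (hh1 : hlo ≤ den * (star ψ ⬝ᵥ A *ᵥ ψ).re) (hh2 : den * (star ψ ⬝ᵥ A *ᵥ ψ).re ≤ hhi)
    (hh2hi : den ^ 2 * (star ψ ⬝ᵥ (A * A) *ᵥ ψ).re ≤ h2hi)
    (hβ : cornerMax hlo hhi (den * nlo) (den * nhi) < β) :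
    templeLower β (cornerMin hlo hhi (den * nlo) (den * nhi)) (cornerMax hlo hhi (den * nlo) (den * nhi))
        (cornerMax h2lo h2hi (den ^ 2 * nlo) (den ^ 2 * nhi)) ≤ A.minEnergyOn K := by
  set n : ℝ := (star ψ ⬝ᵥ ψ).re with hn
  set a : ℝ := (star ψ ⬝ᵥ A *ᵥ ψ).re with ha
  set b : ℝ := (star ψ ⬝ᵥ (A * A) *ᵥ ψ).re with hb
  have hnpos : 0 < n := re_star_dotProduct_self_pos h0
  have hden2 : 0 < den ^ 2 := pow_pos hden 2
  -- the true quotients in the reader's scaled form, and their enclosures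
  have hμ : a / n = den * a / (den * n) := (mul_div_mul_left_pos hden).symm
  have hm2 : b / n = den ^ 2 * b / (den ^ 2 * n) := (mul_div_mul_left_pos hden2).symm
  have hy1 : den * nlo ≤ den * n := mul_le_mul_of_nonneg_left hn1 hden.le
  have hy2 : den * n ≤ den * nhi := mul_le_mul_of_nonneg_left hn2 hden.le
  have hy1' : den ^ 2 * nlo ≤ den ^ 2 * n := mul_le_mul_of_nonneg_left hn1 hden2.le
  have hy2' : den ^ 2 * n ≤ den ^ 2 * nhi := mul_le_mul_of_nonneg_left hn2 hden2.le
  have hμlo : cornerMin hlo hhi (den * nlo) (den * nhi) ≤ a / n := by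
    rw [hμ]; exact cornerMin_le_div (mul_pos hden hnlo) hy1 hy2 hh1
  have hμhi : a / n ≤ cornerMax hlo hhi (den * nlo) (den * nhi) := by
    rw [hμ]; exact div_le_cornerMax (mul_pos hden hnlo) hy1 hy2 hh2
  have hm2hi : b / n ≤ cornerMax h2lo h2hi (den ^ 2 * nlo) (den ^ 2 * nhi) := by
    rw [hm2]; exact div_le_cornerMax (mul_pos hden2 hnlo) hy1' hy2' hh2hi
  have hμβ : a / n < β := lt_of_le_of_lt hμhi hβ
  -- normalise the witness: `ψ₁ = c • ψ`, `⟨ψ₁, ψ₁⟩ = 1`, `c² · n = 1`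
  obtain ⟨c, hc, hcc, h1⟩ := exists_normalize h0
  have hψ1K : (c : ℂ) • ψ ∈ K := K.smul_mem _ hψ
  have hcn : c * c = 1 / n := by
    rw [eq_div_iff hnpos.ne']; exact hcc
  have hA1 : (star ((c : ℂ) • ψ) ⬝ᵥ A *ᵥ ((c : ℂ) • ψ)).re = a / n := by
    rw [mulVec_smul, star_real_smul_dotProduct_real_smul, Complex.re_ofReal_mul, hcn, ← ha]
    ring
  have hA2 : (star ((c : ℂ) • ψ) ⬝ᵥ (A * A) *ᵥ ((c : ℂ) • ψ)).re = b / n := by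
    rw [mulVec_smul, star_real_smul_dotProduct_real_smul, Complex.re_ofReal_mul, hcn, ← hb]
    ring
  -- Temple's inequality for the normalised witness
  have hT := templeInequality_holds A hA K hKA β hgap ((c : ℂ) • ψ) hψ1K h1 (by rw [hA1]; exact hμβ)
  rw [hA1, hA2] at hT
  -- `μ − (m₂ − μ²)/(β − μ) = (β μ − m₂)/(β − μ)`
  have hβμ : β - a / n ≠ 0 := ne_of_gt (by linarith)
  rw [temple_expr_eq hβμ] at hT
  exact (templeLower_le hμlo hμhi hβ hm2hi).trans hT

end Operator

/-! ## §G  The `(N↑, N↓)` sector of the spinful Fock space -/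

section Sector

variable {Λ : Type*} [LinearOrder Λ] [Fintype Λ]

/-- **PHASE C window in the `(a, b)` sector.**  For a Hermitian `H` on the spinful Fock space over the box
orbitals commuting with `N̂` and `Ŝ_z` (every Hubbard-family box Hamiltonian of the programme), a nonzero
witness `ψ` of the `(N↑, N↓) = (a, b)` sector (FORMAT-mps1 states are `U(1)²` block-sparse), the reader
enclosures of `weinstein_window_sound` and a printed half-width `s ≥ 0` with `var_hi ≤ s²`: the printed window
contains an eigenvalue of `H` that has an eigenvector IN THE SECTOR.  (Tree inputs: `mulVec_mem_szSector_of_commute`,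
`mem_szSector_iff_isInSector`.)  Box diagnostic; no TL or order-parameter content. -/
theorem weinstein_window_sound_sector {H : Matrix (Finset (Orb Λ)) (Finset (Orb Λ)) ℂ} (hH : H.IsHermitian)
    (hN : Commute H totalNumber) (hS : Commute H HubbardWave0.spinZ) {a b : ℕ} {ψ : Fock (Orb Λ)}
    (hψ : IsInSector a b ψ) (h0 : ψ ≠ 0)
    {den nlo nhi hlo hhi h2lo h2hi s : ℝ} (hden : 0 < den) (hnlo : 0 < nlo)
    (hn1 : nlo ≤ (star ψ ⬝ᵥ ψ).re) (hn2 : (star ψ ⬝ᵥ ψ).re ≤ nhi)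
    (hh1 : hlo ≤ den * (star ψ ⬝ᵥ H *ᵥ ψ).re) (hh2 : den * (star ψ ⬝ᵥ H *ᵥ ψ).re ≤ hhi)
    (hh2hi : den ^ 2 * (star ψ ⬝ᵥ (H * H) *ᵥ ψ).re ≤ h2hi) (hs : 0 ≤ s)
    (hs2 : varHi (cornerMax h2lo h2hi (den ^ 2 * nlo) (den ^ 2 * nhi))
      (cornerMin hlo hhi (den * nlo) (den * nhi)) (cornerMax hlo hhi (den * nlo) (den * nhi)) ≤ s ^ 2) :
    ∃ e : ℝ, (∃ v : Fock (Orb Λ), IsInSector a b v ∧ v ≠ 0 ∧ H *ᵥ v = (e : ℂ) • v) ∧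
      cornerMin hlo hhi (den * nlo) (den * nhi) - s ≤ e ∧
        e ≤ cornerMax hlo hhi (den * nlo) (den * nhi) + s := by
  classical
  obtain ⟨e, ⟨v, hvK, hv0, hHv⟩, hwin⟩ := weinstein_window_sound hH
    (szSector (a + b) (((a : ℝ) - b) / 2)) (fun _ hφ => mulVec_mem_szSector_of_commute hN hS hφ)
    ((mem_szSector_iff_isInSector a b ψ).2 hψ) h0 hden hnlo hn1 hn2 hh1 hh2 hh2hi hs hs2
  exact ⟨e, ⟨v, (mem_szSector_iff_isInSector a b v).1 hvK, hv0, hHv⟩, hwin⟩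

end Sector

end Summit.Ventures.CertifiedManyBodySolver.Upper.IntervalReader

end
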